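import Literature.Geometry.Lorentzian.DiagonalMetricCoord
import Literature.Geometry.Lorentzian.ChartMetricCoord
import Literature.Geometry.Riemannian.IsotropicCurvature
import Literature.Geometry.Lorentzian.Basic
import Mathlib.Analysis.Calculus.ContDiff.Deriv
import HarnessLib

/-!
# Riemannian diagonal chart metrics depending on one coordinate: the sectional curvatures

Support file (everything proved, no named facts) for the Gromov–Thurston `2π` theorem
(`Literature.Geometry.Riemannian.gromovThurston_twoPi_four`, file `CuspedHyperbolic.lean`), whose
proof smooths the hyperbolic cusp metric `e^{-2t}|dy|² + dt²` inside a Dehn filling into a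
multiply warped model `β(t)(dy₀² + dy₁²) + γ(t) dy₂² + α(t) dt²` (Anderson 2006, §2.1: "one forms
the Euclidean cone … and takes the constant skew product with the flat metric on `T^{n-2}` … A
natural smoothing of this cone singularity gives a metric of non-positive curvature").

For a Riemannian metric on a chart domain `V : Opens E4` whose components are *diagonal* and
depend only on the last coordinate `t = y³`, `G_y = ∑ᵢ cᵢ(y³) dyⁱ ⊗ dyⁱ`, we compute the covariant
curvature tensor on coordinate vectors in closed form (O'Neill 1983, Ch. 3, Lemma 3.38 via the
tree's `MetricCoord.apply_riemAt_diagMetric_eb`) and deduce the classical formula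
`Rm(Y, Z, Z, Y) = ∑_{a<b} S_{ab} (Y_a Z_b − Y_b Z_a)²` with
`S_{a3} = −(c_a''/2 − c_a'²/(4c_a) − c₃' c_a'/(4c₃))` (`a < 3`) and `S_{ab} = −c_a' c_b'/(4c₃)`
(`a < b < 3`) — the sectional curvatures `−f_a''/f_a`, `−f_a' f_b'/(f_a f_b)` of the multiply
warped product `ds² + ∑ f_a(s)² dy_a²` written in the coordinate `t` (O'Neill 1983, Ch. 7,
Prop. 7.42; Bishop–O'Neill 1969, §7). Consequently (`curvatureForm_oneVarMetric_nonpos`) the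
metric has nonpositive sectional curvature, `Rm(Y,Z,Z,Y) ≤ 0`, as soon as the warping functions
are convex in arclength (`c_a''/2 − c_a'²/(4c_a) − c₃'c_a'/(4c₃) ≥ 0`) and monotone in the same
direction (`c_a' c_b' ≥ 0`).

## Contents

* `diagRiemannian V g hg hpos` — the `C^∞` Riemannian metric on `V : Opens E4` with positive
  smooth diagonal components `g i` (the Riemannian sibling of `OpensChart.diagLorentz`);
  `isRiemannian_diagRiemannian`, `riemann_diagRiemannian`, `curvatureForm_diagRiemannian`;
* `apply_riemAt_eq_sum₄` — quadrilinear expansion of `G(R(X,Y)Z, W)` over the coordinate basis;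
* `oneVar c i y = c i (y 3)`, `fderiv_oneVar_eb`, `fderiv_fderiv_oneVar_eb` — derivative tables;
* `oneVarS`, `oneVarR`, `oneVar_core` — the closed form of the `4⁴` paired components;
* `sum₄_oneVarR` — `∑ Y_a Z_b Z_c Y_e R_{abce} = ∑_{a<b} S_{ab}(Y_aZ_b − Y_bZ_a)²`;
* `oneVarMetric V c hc hcpos` — the metric `diagRiemannian V (oneVar c) …` for smooth positive
  `cᵢ : ℝ → ℝ`; `curvatureForm_oneVarMetric_eq`, `curvatureForm_oneVarMetric_nonpos` — the formula
  and the sign of `Rm(Y,Z,Z,Y)`.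

## References

* B. O'Neill, *Semi-Riemannian geometry with applications to relativity*, Academic Press 1983,
  Ch. 3, Lemma 3.38 (curvature in coordinates); Ch. 7, Prop. 7.42 (warped products). [ONeill1983]
* M. T. Anderson, *Dehn filling and Einstein metrics in higher dimensions*, J. Differential
  Geom. 73 (2006) 219–261, §2.1. [Anderson2006]
-/

noncomputable section

set_option maxSynthPendingDepth 3

open Set Filter TopologicalSpace Bundle
open scoped Topology ContDiff Manifold

namespace Literature.Geometry.Riemannian

open Literature.Geometry.Lorentzian Literature.Geometry.Lorentzian.MetricCoord
  Literature.Geometry.Lorentzian.OpensChart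

/-! ### Riemannian diagonal chart metrics -/

/-- **The Riemannian metric of positive diagonal components on a chart domain.** For scalar
functions `gᵢ > 0`, smooth on the open set `V ⊆ E4`, the components `G_y = ∑ gᵢ(y) dyⁱ ⊗ dyⁱ`
define a `C^∞` Riemannian metric on `V : Opens E4` (a metric in orthogonal coordinates; O'Neill
1983, Ch. 3, Def. 3.1 and p. 60). The Riemannian sibling of `OpensChart.diagLorentz`.
[cite: ONeill1983, Ch. 3, Def. 3.1] -/
def diagRiemannian (V : Opens E4) (g : Fin 4 → E4 → ℝ) (hg : ∀ i, ContDiffOn ℝ ∞ (g i) V)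
    (hpos : ∀ i, ∀ y ∈ (V : Set E4), 0 < g i y) :
    PseudoRiemannianMetric 𝓘(ℝ, E4) ∞ E4 (TangentSpace 𝓘(ℝ, E4) : V → Type _) where
  val y := diagMetric g y.1
  symm y v w := diagForm_symm _ v w
  nondegenerate y v hv := by
    have hc : ∀ i, g i y.1 ≠ 0 := fun i ↦ (hpos i y.1 y.2).ne'
    have hinv := isInvertible_diagForm (c := fun i ↦ g i y.1) hc
    have hz : diagForm (fun i ↦ g i y.1) (show E4 from v) = diagForm (fun i ↦ g i y.1) 0 := by
      rw [map_zero]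
      ext w
      exact hv w
    exact hinv.injective hz
  contMDiff y :=
    (contMDiffAt_bilinSection_iff y _ (diagMetric g) (fun _ ↦ rfl)).2
      ((contDiffOn_diagMetric hg).contDiffAt (V.2.mem_nhds y.2))

variable {V : Opens E4} {g : Fin 4 → E4 → ℝ} {hg : ∀ i, ContDiffOn ℝ ∞ (g i) V}
  {hpos : ∀ i, ∀ y ∈ (V : Set E4), 0 < g i y}

/-- The value of the diagonal metric is the diagonal components (by definition). [folklore] -/
@[simp]
theorem diagRiemannian_val (y : V) : (diagRiemannian V g hg hpos).val y = diagMetric g y.1 := rfl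

/-- The representative hypothesis `g.val y = G y` of the `OpensChart` calculus, for the diagonal
metric. [folklore] -/
theorem diagRiemannian_repr :
    ∀ y : V, (diagRiemannian V g hg hpos).val y = diagMetric g y.1 :=
  fun _ ↦ rfl

/-- A diagonal metric with positive entries is Riemannian: `G(v,v) = ∑ gᵢ vᵢ² > 0` for `v ≠ 0`.
[cite: ONeill1983, Ch. 3, p. 55] -/
theorem isRiemannian_diagRiemannian : (diagRiemannian V g hg hpos).IsRiemannian := by
  intro y v hv
  change E4 at v
  change 0 < diagMetric g y.1 v v
  rw [diagMetric_apply]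
  obtain ⟨i, hi⟩ : ∃ i, v i ≠ 0 := by
    by_contra h
    simp only [not_exists, not_not] at h
    apply hv
    change (v : E4) = (0 : E4)
    ext i
    simpa using h i
  have hle : ∀ j ∈ (Finset.univ : Finset (Fin 4)), 0 ≤ g j y.1 * (v j * v j) :=
    fun j _ ↦ mul_nonneg (hpos j y.1 y.2).le (mul_self_nonneg _)
  have hlt : 0 < g i y.1 * (v i * v i) :=
    mul_pos (hpos i y.1 y.2) (mul_self_pos.mpr hi)
  exact lt_of_lt_of_le hlt (Finset.single_le_sum hle (Finset.mem_univ i))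

/-- **The Riemann tensor of the diagonal chart metric is the coordinate curvature**
(`OpensChart.riemann_eq_riemAt`). [cite: ONeill1983, Ch. 3, Lemma 3.38] -/
theorem riemann_diagRiemannian [(diagRiemannian V g hg hpos).HasLeviCivita] (y : V) (X Y Z : E4) :
    (diagRiemannian V g hg hpos).riemann y X Y Z = riemAt (diagMetric g) y X Y Z :=
  riemann_eq_riemAt (diagRiemannian_repr (hg := hg) (hpos := hpos)) y X Y Z

/-- **`Rm(X,Y,Z,W)` of the diagonal chart metric is the paired coordinate curvature**
`G(riemAt X Y Z, W)` (for the Levi-Civita connection). [cite: ONeill1983, Ch. 3, Lemma 3.38] -/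
theorem curvatureForm_diagRiemannian [(diagRiemannian V g hg hpos).HasLeviCivita] (y : V)
    (X Y Z W : E4) :
    (diagRiemannian V g hg hpos).curvatureForm (diagRiemannian V g hg hpos).leviCivita y X Y Z W =
      diagMetric g y.1 (riemAt (diagMetric g) y X Y Z) W := by
  unfold PseudoRiemannianMetric.curvatureForm
  rw [show (diagRiemannian V g hg hpos).leviCivita.curvature y X Y Z =
      (diagRiemannian V g hg hpos).riemann y X Y Z from rfl, riemann_diagRiemannian y X Y Z]
  rfl

/-! ### Quadrilinear expansion over the coordinate basis -/

/-- Expansion of a vector of `E4` in the coordinate vectors `eᵢ`. [folklore] -/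
theorem eq_sum_eb (X : E4) : X = ∑ a, X a • (eb a : E4) := by
  simpa using ((EuclideanSpace.basisFun (Fin 4) ℝ).sum_repr X).symm

/-- `riemAt` is additive over finite sums in its first slot. [folklore] -/
theorem riemAt_sum_left (G : E4 → E4 →L[ℝ] E4 →L[ℝ] ℝ) (y : E4) (s : Finset (Fin 4))
    (f : Fin 4 → ℝ) (Y Z : E4) :
    riemAt G y (∑ a ∈ s, f a • (eb a : E4)) Y Z = ∑ a ∈ s, f a • riemAt G y (eb a) Y Z := by
  classical
  induction s using Finset.induction_on with
  | empty =>
    simp only [Finset.sum_empty]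
    rw [show (0 : E4) = (0 : ℝ) • (eb 0 : E4) by simp, riemAt_smul_left]
    simp
  | insert a s ha ih =>
    rw [Finset.sum_insert ha, Finset.sum_insert ha, riemAt_add_left, _root_.add_apply,
      riemAt_smul_left, FunLike.coe_smul, Pi.smul_apply, ih]

/-- `riemAt` is additive over finite sums in its second slot. [folklore] -/
theorem riemAt_sum_right (G : E4 → E4 →L[ℝ] E4 →L[ℝ] ℝ) (y : E4) (s : Finset (Fin 4))
    (f : Fin 4 → ℝ) (X Z : E4) :
    riemAt G y X (∑ b ∈ s, f b • (eb b : E4)) Z = ∑ b ∈ s, f b • riemAt G y X (eb b) Z := by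
  classical
  induction s using Finset.induction_on with
  | empty =>
    simp only [Finset.sum_empty]
    rw [show (0 : E4) = (0 : ℝ) • (eb 0 : E4) by simp, riemAt_smul_right]
    simp
  | insert b s hb ih =>
    rw [Finset.sum_insert hb, Finset.sum_insert hb, riemAt_add_right, _root_.add_apply,
      riemAt_smul_right, FunLike.coe_smul, Pi.smul_apply, ih]

/-- **Quadrilinear expansion of the paired coordinate curvature over the coordinate basis**:
`B(R(X,Y)Z, W) = ∑_{a,b,c,e} X_a Y_b Z_c W_e B(R(e_a,e_b)e_c, e_e)` for any continuous bilinear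
pairing `B`. [folklore] -/
theorem apply_riemAt_eq_sum₄ (G : E4 → E4 →L[ℝ] E4 →L[ℝ] ℝ) (B : E4 →L[ℝ] E4 →L[ℝ] ℝ)
    (y X Y Z W : E4) :
    B (riemAt G y X Y Z) W =
      ∑ a, ∑ b, ∑ c, ∑ e, X a * Y b * Z c * W e * B (riemAt G y (eb a) (eb b) (eb c)) (eb e) := by
  conv_lhs => rw [eq_sum_eb X, riemAt_sum_left, map_sum, FunLike.coe_sum,
    Finset.sum_apply]
  refine Finset.sum_congr rfl fun a _ ↦ ?_
  rw [map_smul, FunLike.coe_smul, Pi.smul_apply, smul_eq_mul]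
  conv_lhs => rw [eq_sum_eb Y, riemAt_sum_right, map_sum, FunLike.coe_sum,
    Finset.sum_apply, Finset.mul_sum]
  refine Finset.sum_congr rfl fun b _ ↦ ?_
  rw [map_smul, FunLike.coe_smul, Pi.smul_apply, smul_eq_mul]
  conv_lhs => rw [eq_sum_eb Z, map_sum, map_sum, FunLike.coe_sum, Finset.sum_apply,
    Finset.mul_sum, Finset.mul_sum]
  refine Finset.sum_congr rfl fun c _ ↦ ?_
  rw [map_smul, map_smul, FunLike.coe_smul, Pi.smul_apply, smul_eq_mul]
  conv_lhs => rw [eq_sum_eb W, map_sum, Finset.mul_sum, Finset.mul_sum, Finset.mul_sum]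
  refine Finset.sum_congr rfl fun e _ ↦ ?_
  rw [map_smul, smul_eq_mul]
  ring

/-! ### Components depending on the last coordinate only -/

/-- **One-variable components**: `(oneVar c) i y = cᵢ(y³)`, the diagonal entries of the model
metrics `β(t)(dy₀² + dy₁²) + γ(t) dy₂² + α(t) dt²` of the `2π` theorem (`t = y³`).
[cite: Anderson2006, §2.1] -/
def oneVar (c : Fin 4 → ℝ → ℝ) (i : Fin 4) (y : E4) : ℝ := c i (y 3)

/-- The derivative of `y ↦ f(y³)` along `v` is `f'(y³) v³`. [folklore] -/
theorem hasFDerivAt_comp_coord_three {f : ℝ → ℝ} {y : E4} (hf : DifferentiableAt ℝ f (y 3)) :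
    HasFDerivAt (fun z : E4 ↦ f (z 3))
      (deriv f (y 3) • (EuclideanSpace.proj (3 : Fin 4) : E4 →L[ℝ] ℝ)) y := by
  have h1 := (EuclideanSpace.proj (3 : Fin 4) : E4 →L[ℝ] ℝ).hasFDerivAt (x := y)
  have h2 : HasDerivAt f (deriv f (y 3)) ((EuclideanSpace.proj (3 : Fin 4) : E4 →L[ℝ] ℝ) y) :=
    hf.hasDerivAt
  exact h2.comp_hasFDerivAt y h1

/-- `∂_v (f ∘ y³)(y) = f'(y³) v³`. [folklore] -/
theorem fderiv_comp_coord_three {f : ℝ → ℝ} {y : E4} (hf : DifferentiableAt ℝ f (y 3)) (v : E4) :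
    fderiv ℝ (fun z : E4 ↦ f (z 3)) y v = deriv f (y 3) * v 3 := by
  rw [(hasFDerivAt_comp_coord_three hf).fderiv]
  rfl

/-- `y ↦ f(y³)` is smooth when `f` is. [folklore] -/
theorem contDiff_comp_coord_three {f : ℝ → ℝ} {n : ℕ∞ω} (hf : ContDiff ℝ n f) :
    ContDiff ℝ n (fun z : E4 ↦ f (z 3)) :=
  hf.comp (EuclideanSpace.proj (3 : Fin 4) : E4 →L[ℝ] ℝ).contDiff

variable {c : Fin 4 → ℝ → ℝ}

/-- The one-variable components are smooth when the `cᵢ` are. [folklore] -/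
theorem contDiff_oneVar (hc : ∀ i, ContDiff ℝ ∞ (c i)) (i : Fin 4) : ContDiff ℝ ∞ (oneVar c i) :=
  contDiff_comp_coord_three (hc i)

/-- The component of a coordinate vector: `(e_a)³ = [a = 3]`. [folklore] -/
theorem eb_apply_three (a : Fin 4) : (eb a : E4) 3 = if a = 3 then 1 else 0 := by
  rw [eb_apply]
  by_cases h : a = 3
  · subst h; simp
  · simp [h, Ne.symm h]

/-- Table of first derivatives of one-variable components at parameter `t`:
`∂_{a'} cᵢ = [a' = 3] cᵢ'(t)`. [folklore] -/
def oneVarD1 (c : Fin 4 → ℝ → ℝ) (t : ℝ) (i a' : Fin 4) : ℝ :=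
  if a' = 3 then deriv (c i) t else 0

/-- Table of second derivatives of one-variable components at parameter `t`:
`∂_a ∂_{b'} cᵢ = [a = 3 ∧ b' = 3] cᵢ''(t)`. [folklore] -/
def oneVarD2 (c : Fin 4 → ℝ → ℝ) (t : ℝ) (a i b' : Fin 4) : ℝ :=
  if a = 3 ∧ b' = 3 then deriv (deriv (c i)) t else 0

/-- First derivatives of one-variable components on coordinate vectors. [folklore] -/
theorem fderiv_oneVar_eb (hc : ∀ i, ContDiff ℝ ∞ (c i)) (i a' : Fin 4) (y : E4) :
    fderiv ℝ (oneVar c i) y (eb a') = oneVarD1 c (y 3) i a' := by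
  have hd : DifferentiableAt ℝ (c i) (y 3) := ((hc i).differentiable (by simp)).differentiableAt
  unfold oneVar
  rw [fderiv_comp_coord_three hd, eb_apply_three, oneVarD1]
  split_ifs <;> simp

/-- Second derivatives of one-variable components on coordinate vectors. [folklore] -/
theorem fderiv_fderiv_oneVar_eb (hc : ∀ i, ContDiff ℝ ∞ (c i)) (a i b' : Fin 4) (y : E4) :
    fderiv ℝ (fun z ↦ fderiv ℝ (oneVar c i) z (eb b')) y (eb a) = oneVarD2 c (y 3) a i b' := by
  have hfun : (fun z ↦ fderiv ℝ (oneVar c i) z (eb b')) = fun z : E4 ↦ oneVarD1 c (z 3) i b' := by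
    funext z; exact fderiv_oneVar_eb hc i b' z
  rw [hfun]
  by_cases hb : b' = 3
  · subst hb
    have hfun' : (fun z : E4 ↦ oneVarD1 c (z 3) i 3) = fun z : E4 ↦ deriv (c i) (z 3) := by
      funext z; simp [oneVarD1]
    have hd : DifferentiableAt ℝ (deriv (c i)) (y 3) :=
      ((contDiff_infty_iff_deriv.1 (hc i)).2.differentiable (by simp)).differentiableAt
    rw [hfun', fderiv_comp_coord_three hd, eb_apply_three, oneVarD2]
    split_ifs <;> simp_all
  · have hfun' : (fun z : E4 ↦ oneVarD1 c (z 3) i b') = fun _ : E4 ↦ (0 : ℝ) := by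
      funext z; simp [oneVarD1, hb]
    rw [hfun']
    simp [oneVarD2, hb]

/-! ### The algebraic core: all paired components on coordinate vectors -/

/-- **The sectional table** of a one-variable diagonal metric with values `v`, first derivatives
`d` and second derivatives `dd` of the entries at the parameter: for `a < 3`,
`S(a, 3) = S(3, a) = −(dd_a/2 − d_a²/(4 v_a) − d₃ d_a/(4 v₃))` (`= Rm(e_a, e₃, e₃, e_a)`), and for
`a ≠ b < 3`, `S(a, b) = −d_a d_b/(4 v₃)` (`= Rm(e_a, e_b, e_b, e_a)`): the numerators of the
sectional curvatures `−f_a''/f_a` and `−f_a'f_b'/(f_a f_b)` of a multiply warped product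
(O'Neill 1983, Ch. 7, Prop. 7.42). [cite: ONeill1983, Ch. 7, Prop. 7.42] -/
def oneVarS (v d dd : Fin 4 → ℝ) (a b : Fin 4) : ℝ :=
  if b = 3 then -(dd a / 2 - d a ^ 2 / (4 * v a) - d 3 * d a / (4 * v 3))
  else if a = 3 then -(dd b / 2 - d b ^ 2 / (4 * v b) - d 3 * d b / (4 * v 3))
  else -(d a * d b / (4 * v 3))

/-- **The paired curvature components** `R_{abce} = G(R(e_a,e_b)e_c, e_e)` of a one-variable
diagonal metric: `R_{abba} = S(a,b)`, `R_{abab} = −S(a,b)` (`a ≠ b`), all others vanish — the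
curvature operator is diagonal on the coordinate bivectors (O'Neill 1983, Ch. 7, Prop. 7.42).
[cite: ONeill1983, Ch. 7, Prop. 7.42] -/
def oneVarR (v d dd : Fin 4 → ℝ) (a b c e : Fin 4) : ℝ :=
  if a = b then 0
  else if c = b ∧ e = a then oneVarS v d dd a b
  else if c = a ∧ e = b then -oneVarS v d dd a b
  else 0

set_option maxHeartbeats 4000000 in
/-- **The algebraic core** (O'Neill 1983, Ch. 3, Lemma 3.38 evaluated for orthogonal coordinates
depending on `y³` alone): with the Kronecker tables `[a'=3] dᵢ`, `[a=3 ∧ b'=3] ddᵢ`, the `4⁴`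
first-kind expressions of `MetricCoord.apply_riemAt_diagMetric_eb` equal `oneVarR`.
[cite: ONeill1983, Ch. 3, Lemma 3.38] -/
theorem oneVar_core (v d dd : Fin 4 → ℝ) (hv : ∀ i, v i ≠ 0) (a b c e : Fin 4) :
    2⁻¹ * (kd (fun i b' ↦ if a = 3 ∧ b' = 3 then dd i else 0) b c e
          - kd (fun i b' ↦ if b = 3 ∧ b' = 3 then dd i else 0) a c e)
      - ∑ m, kd (fun i a' ↦ if a' = 3 then d i else 0) b c m
          * kd (fun i a' ↦ if a' = 3 then d i else 0) a e m / (4 * v m)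
      + ∑ m, kd (fun i a' ↦ if a' = 3 then d i else 0) a c m
          * kd (fun i a' ↦ if a' = 3 then d i else 0) b e m / (4 * v m)
      = oneVarR v d dd a b c e := by
  have h0 := hv 0; have h1 := hv 1; have h2 := hv 2; have h3 := hv 3
  fin_cases a <;> fin_cases b <;> fin_cases c <;> fin_cases e <;>
    simp [kd, oneVarR, oneVarS, Fin.sum_univ_four] <;> field_simp <;> ring

/-- **`Rm(Y,Z,Z,Y)` of a one-variable diagonal metric as a sum of squares**:
`∑_{a,b,c,e} Y_a Z_b Z_c Y_e R_{abce} = ∑_{a<b} S(a,b) (Y_a Z_b − Y_b Z_a)²`.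
[cite: ONeill1983, Ch. 7, Prop. 7.42] -/
theorem sum₄_oneVarR (v d dd : Fin 4 → ℝ) (Y Z : E4) :
    ∑ a, ∑ b, ∑ c, ∑ e, Y a * Z b * Z c * Y e * oneVarR v d dd a b c e =
      oneVarS v d dd 0 1 * (Y 0 * Z 1 - Y 1 * Z 0) ^ 2
      + oneVarS v d dd 0 2 * (Y 0 * Z 2 - Y 2 * Z 0) ^ 2
      + oneVarS v d dd 0 3 * (Y 0 * Z 3 - Y 3 * Z 0) ^ 2
      + oneVarS v d dd 1 2 * (Y 1 * Z 2 - Y 2 * Z 1) ^ 2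
      + oneVarS v d dd 1 3 * (Y 1 * Z 3 - Y 3 * Z 1) ^ 2
      + oneVarS v d dd 2 3 * (Y 2 * Z 3 - Y 3 * Z 2) ^ 2 := by
  have hS : ∀ a b : Fin 4, a ≠ 3 → b ≠ 3 → oneVarS v d dd a b = oneVarS v d dd b a := by
    intro a b ha hb
    simp only [oneVarS, ha, hb, if_false]
    ring
  simp only [Fin.sum_univ_four, oneVarR]
  simp only [Fin.isValue, Fin.reduceEq, and_self, and_true, and_false,
    if_true, if_false, one_ne_zero, zero_ne_one]
  have e10 := hS 1 0 (by decide) (by decide)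
  have e20 := hS 2 0 (by decide) (by decide)
  have e21 := hS 2 1 (by decide) (by decide)
  have e30 : oneVarS v d dd 3 0 = oneVarS v d dd 0 3 := by simp [oneVarS]
  have e31 : oneVarS v d dd 3 1 = oneVarS v d dd 1 3 := by simp [oneVarS]
  have e32 : oneVarS v d dd 3 2 = oneVarS v d dd 2 3 := by simp [oneVarS]
  rw [e10, e20, e21, e30, e31, e32]
  ring

/-- **Sign of the sum of squares**: if every `S(a,b) ≤ 0` then
`∑ Y_a Z_b Z_c Y_e R_{abce} ≤ 0`. [folklore] -/
theorem sum₄_oneVarR_nonpos (v d dd : Fin 4 → ℝ) (hS : ∀ a b : Fin 4, a < b → oneVarS v d dd a b ≤ 0)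
    (Y Z : E4) :
    ∑ a, ∑ b, ∑ c, ∑ e, Y a * Z b * Z c * Y e * oneVarR v d dd a b c e ≤ 0 := by
  rw [sum₄_oneVarR]
  have h01 := hS 0 1 (by decide)
  have h02 := hS 0 2 (by decide)
  have h03 := hS 0 3 (by decide)
  have h12 := hS 1 2 (by decide)
  have h13 := hS 1 3 (by decide)
  have h23 := hS 2 3 (by decide)
  have s01 := sq_nonneg (Y 0 * Z 1 - Y 1 * Z 0)
  have s02 := sq_nonneg (Y 0 * Z 2 - Y 2 * Z 0)
  have s03 := sq_nonneg (Y 0 * Z 3 - Y 3 * Z 0)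
  have s12 := sq_nonneg (Y 1 * Z 2 - Y 2 * Z 1)
  have s13 := sq_nonneg (Y 1 * Z 3 - Y 3 * Z 1)
  have s23 := sq_nonneg (Y 2 * Z 3 - Y 3 * Z 2)
  nlinarith [mul_nonpos_of_nonpos_of_nonneg h01 s01, mul_nonpos_of_nonpos_of_nonneg h02 s02,
    mul_nonpos_of_nonpos_of_nonneg h03 s03, mul_nonpos_of_nonpos_of_nonneg h12 s12,
    mul_nonpos_of_nonpos_of_nonneg h13 s13, mul_nonpos_of_nonpos_of_nonneg h23 s23]

/-- **The sectional table is nonpositive** under the convexity conditions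
`dd_a/2 − d_a²/(4v_a) − d₃ d_a/(4v₃) ≥ 0` (`a < 3`) and the monotonicity conditions
`d_a d_b ≥ 0` (`a, b < 3`), given `v₃ > 0`. [cite: ONeill1983, Ch. 7, Prop. 7.42] -/
theorem oneVarS_nonpos (v d dd : Fin 4 → ℝ) (hv3 : 0 < v 3)
    (hconv : ∀ a : Fin 4, a ≠ 3 → 0 ≤ dd a / 2 - d a ^ 2 / (4 * v a) - d 3 * d a / (4 * v 3))
    (hmono : ∀ a b : Fin 4, a ≠ 3 → b ≠ 3 → a ≠ b → 0 ≤ d a * d b) (a b : Fin 4) (hab : a < b) :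
    oneVarS v d dd a b ≤ 0 := by
  have ha3 : a ≠ 3 := by
    intro h; subst h
    exact absurd hab (not_lt.mpr (Fin.le_last b))
  unfold oneVarS
  by_cases hb : b = 3
  · rw [if_pos hb]
    linarith [hconv a ha3]
  · rw [if_neg hb, if_neg ha3]
    have h := hmono a b ha3 hb hab.ne
    have h4 : 0 < 4 * v 3 := by linarith
    have : 0 ≤ d a * d b / (4 * v 3) := div_nonneg h h4.le
    linarith

/-! ### The curvature of the one-variable diagonal metric -/

section Metric

variable (V : Opens E4) (c : Fin 4 → ℝ → ℝ)

/-- Smoothness of the one-variable components on any chart domain. [folklore] -/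
theorem contDiffOn_oneVar (hc : ∀ i, ContDiff ℝ ∞ (c i)) (i : Fin 4) :
    ContDiffOn ℝ ∞ (oneVar c i) V :=
  (contDiff_oneVar hc i).contDiffOn

/-- Positivity of the one-variable components on any chart domain. [folklore] -/
theorem oneVar_pos (hcpos : ∀ i t, 0 < c i t) (i : Fin 4) : ∀ y ∈ (V : Set E4), 0 < oneVar c i y :=
  fun y _ ↦ hcpos i (y 3)

variable (hc : ∀ i, ContDiff ℝ ∞ (c i)) (hcpos : ∀ i t, 0 < c i t)

include hc hcpos

/-- **The one-variable diagonal model metric** `G_y = ∑ᵢ cᵢ(y³) dyⁱ ⊗ dyⁱ` on the chart domain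
`V : Opens E4`, for smooth positive `cᵢ : ℝ → ℝ` (the form of the smoothed cusp metrics of the
`2π` theorem in straightened cusp coordinates, Anderson 2006, §2.1). [cite: Anderson2006, §2.1] -/
def oneVarMetric : PseudoRiemannianMetric 𝓘(ℝ, E4) ∞ E4 (TangentSpace 𝓘(ℝ, E4) : V → Type _) :=
  diagRiemannian V (oneVar c) (fun i ↦ contDiffOn_oneVar V c hc i) (oneVar_pos V c hcpos)

/-- The value of the model metric. [folklore] -/
@[simp]
theorem oneVarMetric_val (y : V) :
    (oneVarMetric V c hc hcpos).val y = diagMetric (oneVar c) y.1 := rfl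

/-- The model metric in coordinates: `G_y(v, w) = ∑ᵢ cᵢ(y³) vᵢ wᵢ`. [folklore] -/
theorem oneVarMetric_val_apply (y : V) (v w : E4) :
    (oneVarMetric V c hc hcpos).val y v w = ∑ i, c i (y.1 3) * (v i * w i) := by
  change diagMetric (oneVar c) y.1 v w = _
  rw [diagMetric_apply]
  rfl

/-- The model metric is Riemannian. [folklore] -/
theorem isRiemannian_oneVarMetric : (oneVarMetric V c hc hcpos).IsRiemannian :=
  isRiemannian_diagRiemannian

/-- **The paired curvature components of the model metric on coordinate vectors** are the table
`oneVarR` of the values and first two derivatives of the `cᵢ` at `t = y³`.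
[cite: ONeill1983, Ch. 3, Lemma 3.38] -/
theorem apply_riemAt_oneVar_eb (y : V) (a b c' e : Fin 4) :
    diagMetric (oneVar c) y.1 (riemAt (diagMetric (oneVar c)) y.1 (eb a) (eb b) (eb c')) (eb e) =
      oneVarR (fun i ↦ c i (y.1 3)) (fun i ↦ deriv (c i) (y.1 3))
        (fun i ↦ deriv (deriv (c i)) (y.1 3)) a b c' e := by
  have hne : ∀ i, ∀ z ∈ (V : Set E4), oneVar c i z ≠ 0 := fun i z _ ↦ (hcpos i (z 3)).ne'
  rw [apply_riemAt_diagMetric_eb V.2 (fun i ↦ contDiffOn_oneVar V c hc i) hne y.2]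
  simp only [fderiv_fderiv_oneVar_eb hc]
  simp only [fderiv_oneVar_eb hc, oneVarD1, oneVarD2]
  have hv : ∀ i, (fun i ↦ c i (y.1 3)) i ≠ 0 := fun i ↦ (hcpos i (y.1 3)).ne'
  have h := oneVar_core (fun i ↦ c i (y.1 3)) (fun i ↦ deriv (c i) (y.1 3))
    (fun i ↦ deriv (deriv (c i)) (y.1 3)) hv a b c' e
  simpa only [oneVar] using h

/-- `Rm(X,Y,Z,W)` of the model metric is the paired coordinate curvature of its components.
[cite: ONeill1983, Ch. 3, Lemma 3.38] -/
theorem curvatureForm_oneVarMetric [(oneVarMetric V c hc hcpos).HasLeviCivita] (y : V)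
    (X Y Z W : E4) :
    (oneVarMetric V c hc hcpos).curvatureForm (oneVarMetric V c hc hcpos).leviCivita y X Y Z W =
      diagMetric (oneVar c) y.1 (riemAt (diagMetric (oneVar c)) y X Y Z) W :=
  @curvatureForm_diagRiemannian V (oneVar c) (fun i ↦ contDiffOn_oneVar V c hc i)
    (oneVar_pos V c hcpos) ‹_› y X Y Z W

/-- **`Rm(Y,Z,Z,Y)` of the model metric, expanded**: the quadrilinear sum of the table `oneVarR`
of the values and first two derivatives of the `cᵢ` at `t = y³`.
[cite: ONeill1983, Ch. 3, Lemma 3.38] -/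
theorem curvatureForm_oneVarMetric_eq [(oneVarMetric V c hc hcpos).HasLeviCivita] (y : V)
    (Y Z : E4) :
    (oneVarMetric V c hc hcpos).curvatureForm (oneVarMetric V c hc hcpos).leviCivita y Y Z Z Y =
      ∑ a, ∑ b, ∑ c', ∑ e, Y a * Z b * Z c' * Y e *
        oneVarR (fun i ↦ c i (y.1 3)) (fun i ↦ deriv (c i) (y.1 3))
          (fun i ↦ deriv (deriv (c i)) (y.1 3)) a b c' e := by
  rw [curvatureForm_oneVarMetric, apply_riemAt_eq_sum₄]
  refine Finset.sum_congr rfl fun a _ ↦ Finset.sum_congr rfl fun b _ ↦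
    Finset.sum_congr rfl fun c' _ ↦ Finset.sum_congr rfl fun e _ ↦ ?_
  rw [apply_riemAt_oneVar_eb V c hc hcpos y a b c' e]

/-- **Nonpositive sectional curvature of the one-variable diagonal model.** If at the parameter
`t = y³` of a point `y ∈ V` the entries satisfy the convexity conditions
`cₐ''/2 − cₐ'²/(4cₐ) − c₃' cₐ'/(4c₃) ≥ 0` for `a < 3` (convexity of the warping functions `√cₐ` in
arclength `ds = √c₃ dt`) and the monotonicity conditions `cₐ' c_b' ≥ 0` for `a ≠ b < 3`, then
`Rm(Y, Z, Z, Y) ≤ 0` at `y` for all `Y, Z` (O'Neill 1983, Ch. 7, Prop. 7.42: the sectional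
curvatures of a multiply warped product are `−fₐ''/fₐ`, `−fₐ'f_b'/(fₐ f_b)`, and the curvature
operator is diagonal on coordinate bivectors). This is the curvature half of the Gromov–Thurston
smoothing (Anderson 2006, §2.1). [cite: ONeill1983, Ch. 7, Prop. 7.42] [cite: Anderson2006, §2.1] -/
theorem curvatureForm_oneVarMetric_nonpos [(oneVarMetric V c hc hcpos).HasLeviCivita] (y : V)
    (hconv : ∀ a : Fin 4, a ≠ 3 →
      0 ≤ deriv (deriv (c a)) (y.1 3) / 2 - deriv (c a) (y.1 3) ^ 2 / (4 * c a (y.1 3))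
        - deriv (c 3) (y.1 3) * deriv (c a) (y.1 3) / (4 * c 3 (y.1 3)))
    (hmono : ∀ a b : Fin 4, a ≠ 3 → b ≠ 3 → a ≠ b → 0 ≤ deriv (c a) (y.1 3) * deriv (c b) (y.1 3))
    (Y Z : E4) :
    (oneVarMetric V c hc hcpos).curvatureForm (oneVarMetric V c hc hcpos).leviCivita y Y Z Z Y
      ≤ 0 := by
  rw [curvatureForm_oneVarMetric_eq]
  refine sum₄_oneVarR_nonpos _ _ _ (fun a b hab ↦ ?_) Y Z
  exact oneVarS_nonpos _ _ _ (hcpos 3 _) hconv hmono a b hab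

end Metric

end Literature.Geometry.Riemannian
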